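import Mathlib
import HarnessLib
import Literature.Geometry.Lorentzian.KerrConvergence
import Literature.Geometry.Lorentzian.QuasiFinalStateDecomposition
import Summits.FinalStateConjecture.FinalStateConjecture.Statement

/-!
# Route LogTimeThreeAnnuli · crux `DyadicCapture` — the clause bundles of the honest era (definitions)

Route-posited vocabulary (`Theorems/<RouteSlug>…Defs.lean`, reviewed) for the crux
`Summit.FinalStateConjecture.FinalStateConjecture.Theses.LogTimeThreeAnnuli.DyadicCapture` and its line
`registered` (`Cruxes/DyadicCapture/Lines/birth.lean`). The crux reads `ERA(𝒟) → CONCL(𝒟)`; its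
antecedent is an `∃`-block over a reference chart system `d : QuasiFinalStateDecomposition 𝒟 O 2 ⊤` with
growing radii `R`, a window `(m₀, χ)` and THIRTEEN clauses, which the line's stubs repeat verbatim
several times (so that registered stub signatures approach the registry's length cap). This file NAMES
the recurring clause bundles — nothing else: every definition is the literal conjunction of clauses
copied from the route file, and each comes with its `Iff.rfl` unfolding lemma.

* `IsHonestEraSystem 𝒟 O d R` — the eight clauses of the era that concern the reference system alone:
  `O = exteriorOf charted`, rays stay in `closure O`, honest radii, causal exhaustion for every chart time
  `τ₁ > τ₀`, orthochronous motions, the `(M,a)`-uniform covector orientation clause on the truncated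
  slabs, the flat `∂₀` clause, the flat zone `→ η` in every `Cᵏ`
  (Dafermos–Luk arXiv:1710.01722, Conjecture 1 (b)–(c), in the re-typed Statement's clauses).
* `HasWindowedCloseness 𝓢 O d R m₀ χ` — the era's last clause: near zones eventually `ε`-close in every
  `Cᵏ`, on fixed and on growing slabs, to SOME member of the window `m₀ ≤ M ≤ 1/m₀`, `|a| ≤ χM`.
* `HasWindowwiseSummability 𝓢 O d R m₀ χ` — the conclusion clause of `stub_windowwiseSummability`:
  from some dyadic index on, `Σₙ inf_window sup_{τ ∈ [2^(n₀+n), 2^(n₀+n+1)]} (δᵏ_ρ + δᵏ_{Rᵢ τ}) < ∞`.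
* `HasFrozenConvergence 𝓢 O d R M a` — `Cᵏ` convergence, for every `k`, on every fixed slab and on the
  growing slabs, to the FIXED members `(Λᵢ, cᵢ, Mᵢ, aᵢ)` in the reference charts (conclusion of window
  freezing, hypothesis of the rechart).
* `IsSettledSystem 𝒟 O' d'` — for a `C²` `FinalStateDecomposition d'`: sub-extremal holes,
  `O' = exteriorOf charted`, rays stay, `HasExhaustiveCharts`, orthochronous motions, covector clause,
  flat `∂₀` clause (hypotheses of the landed `stub_settledRechart`, which upgrades it to `CONCL`).
* `restrictedRegion / restrictedCharted / restrictedInitialSlabs / restrictedCertifiedLate /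
  restrictedCertifiedSlab` — the images, under the REFERENCE charts, of the late regions / slabs cut down
  to the frozen members' exteriors `{r_{aᵢ} > r₊(Mᵢ,aᵢ)}` and truncated in the frozen radius `r_{aᵢ}`: the
  `charted`, initial-slab and certified sets the recharted system WOULD have, so that the causal clauses of
  the honest rechart (`stub_honestRechart`: `RaysStayInClosure`, exhaustion, covering, late images in
  `O' = exteriorOf 𝒟 (restrictedCharted …)`) can be stated without constructing the recharted system.

Sources: the route file `Theses/LogTimeThreeAnnuli.lean` (items DyadicCapture / DyadicSummability);
Dafermos–Luk arXiv:1710.01722, Conjecture 1; Klainerman, C. R. Mécanique 353 (2025), §2.3 (orbital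
versus asymptotic stability); DHRT arXiv:2104.08222, §1 (the deviation norms).
-/

-- the `Summit.FinalStateConjecture.FinalStateConjecture.…` namespace repeats the summit = sub-problem
-- segment (D-0017 layout, CONVENTIONS §2); the duplicate is deliberate.
set_option linter.dupNamespace false

noncomputable section

namespace Summit.FinalStateConjecture.FinalStateConjecture.Theorems

open Literature.Geometry.Lorentzian
open scoped Topology Manifold ENNReal ContDiff
open Filter Set

/-! ### Clauses of a reference chart system over an arbitrary spacetime -/

section Spacetime

variable (𝓢 : Spacetime.{0} 4) (O : Set 𝓢.carrier) (d : QuasiFinalStateDecomposition 𝓢 O 2 ⊤)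
  (R : Fin d.N → ℝ → ℝ)

/-- **Windowed closeness** (the last clause of the honest subconvergent final era of route
`LogTimeThreeAnnuli`, item `DyadicCapture`): for every hole `i`, order `k`, radius `ρ` and `ε > 0`,
eventually in chart time there is a member `(M, a)` of the compact window `m₀ ≤ M ≤ 1/m₀`, `|a| ≤ χM`
whose boosted Kerr–Schild form `g_{M,a,Λᵢ,cᵢ}` is `ε`-close in `Cᵏ` to `(chart i)^* g` on the fixed slab
`{t*ᵢ = τ, rᵢ ≤ ρ}` and on the growing slab `{t*ᵢ = τ, rᵢ ≤ Rᵢ(τ)}` (both measured in the reference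
background of hole `i`, only the reference field being replaced). Orbital closeness to a FAMILY, the
member free to wander with `τ` (Klainerman 2025, §2.3). [cite: Klainerman2025, §2.3] -/
def HasWindowedCloseness (m₀ χ : ℝ) : Prop :=
  ∀ (i : Fin d.N) (k : ℕ) (ρ : ℝ) (ε : ℝ≥0∞), 0 < ε → ∀ᶠ τ in atTop, ∃ M a : ℝ,
    m₀ ≤ M ∧ M ≤ m₀⁻¹ ∧ |a| ≤ χ * M ∧
    𝓢.truncDeviationCk {d.background i with
        bilin := boostedKerrBilin (d.motion i).1 (d.motion i).2 M a} (d.chart i) k ρ τ ≤ ε ∧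
    𝓢.truncDeviationCk {d.background i with
        bilin := boostedKerrBilin (d.motion i).1 (d.motion i).2 M a} (d.chart i) k (R i τ) τ ≤ ε

/-- **Windowwise dyadic summability** (conclusion clause of the line's `stub_windowwiseSummability`,
the windowwise form of the route's item `DyadicSummability`): for every hole `i`, order `k` and radius
`ρ`, from some dyadic index `n₀` on,
`Σₙ inf_{(M,a) ∈ window} sup_{τ ∈ [2^(n₀+n), 2^(n₀+n+1)]} (δᵏ_ρ(τ; M, a) + δᵏ_{Rᵢ(τ)}(τ; M, a)) < ∞` —
ONE member per closed dyadic annulus (infimum outside the supremum), fixed and growing slab under the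
same infimum. Transplant of Simon's summable-annulus-decay scheme (Ann. Math. 118 (1983)) to dyadic
chart-time annuli, as in the route rationale. [cite: Simon1983, §0] -/
def HasWindowwiseSummability (m₀ χ : ℝ) : Prop :=
  ∀ (i : Fin d.N) (k : ℕ) (ρ : ℝ), ∃ n₀ : ℕ,
    (∑' n : ℕ, ⨅ (M : ℝ) (a : ℝ) (_ : m₀ ≤ M ∧ M ≤ m₀⁻¹ ∧ |a| ≤ χ * M),
      ⨆ τ ∈ Set.Icc ((2 : ℝ) ^ (n₀ + n)) ((2 : ℝ) ^ (n₀ + n + 1)),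
        (𝓢.truncDeviationCk {d.background i with
            bilin := boostedKerrBilin (d.motion i).1 (d.motion i).2 M a} (d.chart i) k ρ τ +
          𝓢.truncDeviationCk {d.background i with
            bilin := boostedKerrBilin (d.motion i).1 (d.motion i).2 M a} (d.chart i) k (R i τ) τ)) ≠ ⊤

/-- **Frozen convergence** (conclusion of window freezing, hypothesis of the rechart): the `Cᵏ`
deviation of `(chart i)^* g` from the FIXED member `g_{Mᵢ,aᵢ,Λᵢ,cᵢ}` tends to `0`, for every `k`, on every
fixed slab `{t*ᵢ = τ, rᵢ ≤ ρ}` and on the growing slabs `{t*ᵢ = τ, rᵢ ≤ Rᵢ(τ)}` of the reference background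
(asymptotic closeness to ONE member in FIXED charts; Klainerman 2025, §2.3; DHRT arXiv:2104.08222, §1).
[cite: arXiv210408222, §1] -/
def HasFrozenConvergence (M a : Fin d.N → ℝ) : Prop :=
  (∀ (i : Fin d.N) (k : ℕ) (ρ : ℝ), Tendsto (fun τ ↦ 𝓢.truncDeviationCk {d.background i with
      bilin := boostedKerrBilin (d.motion i).1 (d.motion i).2 (M i) (a i)} (d.chart i) k ρ τ)
      atTop (𝓝 0)) ∧
  (∀ (i : Fin d.N) (k : ℕ), Tendsto (fun τ ↦ 𝓢.truncDeviationCk {d.background i with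
      bilin := boostedKerrBilin (d.motion i).1 (d.motion i).2 (M i) (a i)} (d.chart i) k (R i τ) τ)
      atTop (𝓝 0))

/-- **Restricted hole region** (route-posited object for the honest rechart of the line `registered`):
the image under the REFERENCE chart of hole `i` of those late points (`t*ᵢ > τ₁`) of the reference domain
whose rest-frame position lies in the exterior `{r_{aᵢ} > r₊(Mᵢ, aᵢ)}` of the FROZEN member `(Mᵢ, aᵢ)` —
the would-be late image of the hole chart recharted on `boostedKerrExterior Λᵢ cᵢ Mᵢ aᵢ` (when that
exterior is contained in the reference domain). Dafermos–Luk arXiv:1710.01722, Conjecture 1 (b) (the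
exterior region, normalised to the event horizon of the FINAL parameters). [cite: DafermosLuk2017, Conjecture 1 (b)] -/
def restrictedRegion (M a : Fin d.N → ℝ) (τ₁ : ℝ) (i : Fin d.N) : Set 𝓢.carrier :=
  d.chart i '' {x | τ₁ < (d.background i).time x.1 ∧
    poincareInv (d.motion i).1 (d.motion i).2 x.1 ∈ Kerr.exterior (M i) (a i)}

/-- **Restricted charted region** after chart time `τ₁`: the flat chart's image of `{x⁰ > τ₁}` together
with the restricted hole regions — the would-be `charted` set of the recharted system (same flat chart,
hole charts restricted to the frozen exteriors, common late time `τ₁`). [cite: DafermosLuk2017, Conjecture 1 (b)] -/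
def restrictedCharted (M a : Fin d.N → ℝ) (τ₁ : ℝ) : Set 𝓢.carrier :=
  d.flatChart '' (Minkowski.backgroundOn d.flatDomain).lateRegion τ₁ ∪ ⋃ i, restrictedRegion 𝓢 O d M a τ₁ i

/-- **Restricted initial slabs** at chart time `τ₁`: the flat chart's image of `{x⁰ = τ₁}` together with
the reference hole charts' images of `{t*ᵢ = τ₁} ∩ {r_{aᵢ} > r₊(Mᵢ,aᵢ)}` — the would-be union of initial
slabs of the recharted system in its covering clause. [cite: DafermosLuk2017, Conjecture 1 (b)] -/
def restrictedInitialSlabs (M a : Fin d.N → ℝ) (τ₁ : ℝ) : Set 𝓢.carrier :=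
  d.flatChart '' (Minkowski.backgroundOn d.flatDomain).timeSlab τ₁ ∪
    ⋃ i, d.chart i '' {x | (d.background i).time x.1 = τ₁ ∧
      poincareInv (d.motion i).1 (d.motion i).2 x.1 ∈ Kerr.exterior (M i) (a i)}

/-- **Restricted certified late region** after `τ₁` with near-zone radii `R'` measured in the FROZEN
member's Kerr–Schild radius `r_{aᵢ}`: flat image of `{x⁰ > τ₁}` plus the reference hole charts' images of
`{t*ᵢ > τ₁, r_{aᵢ} > r₊(Mᵢ,aᵢ), r_{aᵢ} ≤ R'ᵢ(t*ᵢ)}` — the would-be `certifiedLate` of the recharted system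
(Statement clause `HasExhaustiveCharts`). [cite: DafermosLuk2017, Conjecture 1 (b)] -/
def restrictedCertifiedLate (M a : Fin d.N → ℝ) (R' : Fin d.N → ℝ → ℝ) (τ₁ : ℝ) : Set 𝓢.carrier :=
  d.flatChart '' (Minkowski.backgroundOn d.flatDomain).lateRegion τ₁ ∪
    ⋃ i, d.chart i '' {x | τ₁ < (d.background i).time x.1 ∧
      poincareInv (d.motion i).1 (d.motion i).2 x.1 ∈ Kerr.exterior (M i) (a i) ∧
      Kerr.radius (a i) (poincareInv (d.motion i).1 (d.motion i).2 x.1) ≤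
        R' i ((d.background i).time x.1)}

/-- **Restricted certified slab** at `τ₁`: flat image of `{x⁰ = τ₁}` plus the reference hole charts'
images of `{t*ᵢ = τ₁, r_{aᵢ} > r₊(Mᵢ,aᵢ), r_{aᵢ} ≤ R'ᵢ(τ₁)}` — the would-be `certifiedSlab` of the recharted
system. [cite: DafermosLuk2017, Conjecture 1 (b)] -/
def restrictedCertifiedSlab (M a : Fin d.N → ℝ) (R' : Fin d.N → ℝ → ℝ) (τ₁ : ℝ) : Set 𝓢.carrier :=
  d.flatChart '' (Minkowski.backgroundOn d.flatDomain).timeSlab τ₁ ∪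
    ⋃ i, d.chart i '' {x | (d.background i).time x.1 = τ₁ ∧
      poincareInv (d.motion i).1 (d.motion i).2 x.1 ∈ Kerr.exterior (M i) (a i) ∧
      Kerr.radius (a i) (poincareInv (d.motion i).1 (d.motion i).2 x.1) ≤ R' i τ₁}

/-- Unfolding lemma for `restrictedRegion`. [folklore] -/
theorem restrictedRegion_eq (M a : Fin d.N → ℝ) (τ₁ : ℝ) (i : Fin d.N) :
    restrictedRegion 𝓢 O d M a τ₁ i = d.chart i '' {x | τ₁ < (d.background i).time x.1 ∧
      poincareInv (d.motion i).1 (d.motion i).2 x.1 ∈ Kerr.exterior (M i) (a i)} :=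
  rfl

/-- Unfolding lemma for `restrictedCharted`. [folklore] -/
theorem restrictedCharted_eq (M a : Fin d.N → ℝ) (τ₁ : ℝ) :
    restrictedCharted 𝓢 O d M a τ₁ =
      d.flatChart '' (Minkowski.backgroundOn d.flatDomain).lateRegion τ₁ ∪
        ⋃ i, restrictedRegion 𝓢 O d M a τ₁ i :=
  rfl

/-- Unfolding lemma for `restrictedInitialSlabs`. [folklore] -/
theorem restrictedInitialSlabs_eq (M a : Fin d.N → ℝ) (τ₁ : ℝ) :
    restrictedInitialSlabs 𝓢 O d M a τ₁ =
      d.flatChart '' (Minkowski.backgroundOn d.flatDomain).timeSlab τ₁ ∪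
        ⋃ i, d.chart i '' {x | (d.background i).time x.1 = τ₁ ∧
          poincareInv (d.motion i).1 (d.motion i).2 x.1 ∈ Kerr.exterior (M i) (a i)} :=
  rfl

/-- Unfolding lemma for `restrictedCertifiedLate`. [folklore] -/
theorem restrictedCertifiedLate_eq (M a : Fin d.N → ℝ) (R' : Fin d.N → ℝ → ℝ) (τ₁ : ℝ) :
    restrictedCertifiedLate 𝓢 O d M a R' τ₁ =
      d.flatChart '' (Minkowski.backgroundOn d.flatDomain).lateRegion τ₁ ∪
        ⋃ i, d.chart i '' {x | τ₁ < (d.background i).time x.1 ∧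
          poincareInv (d.motion i).1 (d.motion i).2 x.1 ∈ Kerr.exterior (M i) (a i) ∧
          Kerr.radius (a i) (poincareInv (d.motion i).1 (d.motion i).2 x.1) ≤
            R' i ((d.background i).time x.1)} :=
  rfl

/-- Unfolding lemma for `restrictedCertifiedSlab`. [folklore] -/
theorem restrictedCertifiedSlab_eq (M a : Fin d.N → ℝ) (R' : Fin d.N → ℝ → ℝ) (τ₁ : ℝ) :
    restrictedCertifiedSlab 𝓢 O d M a R' τ₁ =
      d.flatChart '' (Minkowski.backgroundOn d.flatDomain).timeSlab τ₁ ∪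
        ⋃ i, d.chart i '' {x | (d.background i).time x.1 = τ₁ ∧
          poincareInv (d.motion i).1 (d.motion i).2 x.1 ∈ Kerr.exterior (M i) (a i) ∧
          Kerr.radius (a i) (poincareInv (d.motion i).1 (d.motion i).2 x.1) ≤ R' i τ₁} :=
  rfl

/-- Unfolding lemma for `HasWindowedCloseness`. [folklore] -/
theorem hasWindowedCloseness_iff (m₀ χ : ℝ) :
    HasWindowedCloseness 𝓢 O d R m₀ χ ↔
      ∀ (i : Fin d.N) (k : ℕ) (ρ : ℝ) (ε : ℝ≥0∞), 0 < ε → ∀ᶠ τ in atTop, ∃ M a : ℝ,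
        m₀ ≤ M ∧ M ≤ m₀⁻¹ ∧ |a| ≤ χ * M ∧
        𝓢.truncDeviationCk {d.background i with
            bilin := boostedKerrBilin (d.motion i).1 (d.motion i).2 M a} (d.chart i) k ρ τ ≤ ε ∧
        𝓢.truncDeviationCk {d.background i with
            bilin := boostedKerrBilin (d.motion i).1 (d.motion i).2 M a} (d.chart i) k (R i τ) τ ≤ ε :=
  Iff.rfl

/-- Unfolding lemma for `HasWindowwiseSummability`. [folklore] -/
theorem hasWindowwiseSummability_iff (m₀ χ : ℝ) :
    HasWindowwiseSummability 𝓢 O d R m₀ χ ↔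
      ∀ (i : Fin d.N) (k : ℕ) (ρ : ℝ), ∃ n₀ : ℕ,
        (∑' n : ℕ, ⨅ (M : ℝ) (a : ℝ) (_ : m₀ ≤ M ∧ M ≤ m₀⁻¹ ∧ |a| ≤ χ * M),
          ⨆ τ ∈ Set.Icc ((2 : ℝ) ^ (n₀ + n)) ((2 : ℝ) ^ (n₀ + n + 1)),
            (𝓢.truncDeviationCk {d.background i with
                bilin := boostedKerrBilin (d.motion i).1 (d.motion i).2 M a} (d.chart i) k ρ τ +
              𝓢.truncDeviationCk {d.background i with
                bilin := boostedKerrBilin (d.motion i).1 (d.motion i).2 M a} (d.chart i) k (R i τ) τ))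
          ≠ ⊤ :=
  Iff.rfl

/-- Unfolding lemma for `HasFrozenConvergence`. [folklore] -/
theorem hasFrozenConvergence_iff (M a : Fin d.N → ℝ) :
    HasFrozenConvergence 𝓢 O d R M a ↔
      (∀ (i : Fin d.N) (k : ℕ) (ρ : ℝ), Tendsto (fun τ ↦ 𝓢.truncDeviationCk {d.background i with
          bilin := boostedKerrBilin (d.motion i).1 (d.motion i).2 (M i) (a i)} (d.chart i) k ρ τ)
          atTop (𝓝 0)) ∧
      (∀ (i : Fin d.N) (k : ℕ), Tendsto (fun τ ↦ 𝓢.truncDeviationCk {d.background i with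
          bilin := boostedKerrBilin (d.motion i).1 (d.motion i).2 (M i) (a i)} (d.chart i) k (R i τ) τ)
          atTop (𝓝 0)) :=
  Iff.rfl

end Spacetime

/-! ### Clauses tied to the Cauchy development: the honest era system and the settled system -/

section Development

variable {X : Type} [TopologicalSpace X] [ChartedSpace E3 X] [IsManifold (𝓡 3) ∞ X]
  [ConnectedSpace X] {D : InitialDataSet (𝓡 3) X}

/-- **Honest era system** (the reference-system clauses of the honest subconvergent final era of
route `LogTimeThreeAnnuli`, item `DyadicCapture`, verbatim): a reference chart system
`d : QuasiFinalStateDecomposition 𝒟 O 2 ⊤` of the vacuum Cauchy development `𝒟` with growing radii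
`Rᵢ` such that (1) `O = exteriorOf 𝒟 charted(d) = J⁺(ιX) ∩ I⁻(charted)`; (2) every future-complete
normalised null ray from the data stays in `closure O` (`RaysStayInClosure`); (3) honest radii
`Rᵢ → ∞`, `Rᵢ(τ) ≥ max(r₊(Mᵢ,aᵢ),0) + 1`; (4) causal exhaustion of `O` by the certified regions for every
chart time `τ₁ > τ₀`; (5) orthochronous motions; (6) the `(M,a)`-uniform covector orientation clause on
the truncated slabs; (7) the flat chart's `∂₀` eventually future-directed; (8) the flat zone `→ η` in
every `Cᵏ`. Dafermos–Luk arXiv:1710.01722, Conjecture 1 (b)–(c), re-typed as in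
`Summits/FinalStateConjecture/FinalStateConjecture/Statement.lean`. [cite: DafermosLuk2017, Conjecture 1 (b)–(c)] -/
def IsHonestEraSystem (𝒟 : VacuumCauchyDevelopment D) (O : Set 𝒟.carrier)
    (d : QuasiFinalStateDecomposition 𝒟.toSpacetime O 2 ⊤) (R : Fin d.N → ℝ → ℝ) : Prop :=
  O = Summit.FinalStateConjecture.exteriorOf 𝒟.toCauchyDevelopment d.charted ∧
  Summit.FinalStateConjecture.RaysStayInClosure 𝒟.toCauchyDevelopment O ∧
  (∀ i : Fin d.N, Tendsto (R i) atTop atTop ∧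
    ∀ τ : ℝ, max (Kerr.rPlus (d.mass i) (d.spin i)) 0 + 1 ≤ R i τ) ∧
  (∀ τ₁ : ℝ, d.τ₀ < τ₁ →
    O \ d.certifiedLate R τ₁ ⊆ 𝒟.metric.causalPast 𝒟.timeOrientation (d.certifiedSlab R τ₁)) ∧
  (∀ i : Fin d.N, Summit.FinalStateConjecture.IsOrthochronous (d.motion i).1) ∧
  (∀ (i : Fin d.N) (ρ : ℝ), ∀ᶠ τ in atTop, ∀ x ∈ (d.background i).truncTimeSlab ρ τ, ∀ w : E4,
    𝒟.timeOrientation.IsFutureDirected (mfderiv 𝓘(ℝ, E4) (𝓡 4) (d.chart i) x w) →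
      0 < ((d.motion i).1 : E4 ≃L[ℝ] E4).symm w 0) ∧
  (∀ᶠ τ in atTop, ∀ x ∈ (Minkowski.backgroundOn d.flatDomain).timeSlab τ,
    𝒟.timeOrientation.IsFutureDirected (mfderiv 𝓘(ℝ, E4) (𝓡 4) d.flatChart x (E4.basisVector 0))) ∧
  (∀ k : ℕ, Tendsto (fun τ ↦ 𝒟.toSpacetime.deviationCk (Minkowski.backgroundOn d.flatDomain)
    d.flatChart k τ) atTop (𝓝 0))

/-- **Settled system** (hypotheses of the landed `stub_settledRechart` of the line `registered`): a
`C²` `FinalStateDecomposition d'` of `O'` with sub-extremal holes, `O' = exteriorOf 𝒟 charted(d')`, rays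
staying in `closure O'`, exhaustive charts (`HasExhaustiveCharts`), orthochronous motions, the covector
orientation clause and the flat `∂₀` clause — the Statement's settling conjunct except that
`IsFutureOriented` is replaced by the covector clause (which implies it, `stub_settledRechart`).
Dafermos–Luk arXiv:1710.01722, Conjecture 1 (b)–(c). [cite: DafermosLuk2017, Conjecture 1 (b)–(c)] -/
def IsSettledSystem (𝒟 : VacuumCauchyDevelopment D) (O' : Set 𝒟.carrier)
    (d' : FinalStateDecomposition 𝒟.toSpacetime O' 2) : Prop :=
  (∀ i, Kerr.IsSubextremal (d'.mass i) (d'.spin i)) ∧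
  O' = Summit.FinalStateConjecture.exteriorOf 𝒟.toCauchyDevelopment d'.charted ∧
  Summit.FinalStateConjecture.RaysStayInClosure 𝒟.toCauchyDevelopment O' ∧
  Summit.FinalStateConjecture.HasExhaustiveCharts d' ∧
  (∀ i : Fin d'.N, Summit.FinalStateConjecture.IsOrthochronous (d'.motion i).1) ∧
  (∀ (i : Fin d'.N) (ρ : ℝ), ∀ᶠ τ in atTop, ∀ x ∈ (d'.background i).truncTimeSlab ρ τ, ∀ w : E4,
    𝒟.timeOrientation.IsFutureDirected (mfderiv 𝓘(ℝ, E4) (𝓡 4) (d'.chart i) x w) →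
      0 < ((d'.motion i).1 : E4 ≃L[ℝ] E4).symm w 0) ∧
  (∀ᶠ τ in atTop, ∀ x ∈ (Minkowski.backgroundOn d'.flatDomain).timeSlab τ,
    𝒟.timeOrientation.IsFutureDirected (mfderiv 𝓘(ℝ, E4) (𝓡 4) d'.flatChart x (E4.basisVector 0)))

/-- Unfolding lemma for `IsHonestEraSystem`. [folklore] -/
theorem isHonestEraSystem_iff (𝒟 : VacuumCauchyDevelopment D) (O : Set 𝒟.carrier)
    (d : QuasiFinalStateDecomposition 𝒟.toSpacetime O 2 ⊤) (R : Fin d.N → ℝ → ℝ) :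
    IsHonestEraSystem 𝒟 O d R ↔
      O = Summit.FinalStateConjecture.exteriorOf 𝒟.toCauchyDevelopment d.charted ∧
      Summit.FinalStateConjecture.RaysStayInClosure 𝒟.toCauchyDevelopment O ∧
      (∀ i : Fin d.N, Tendsto (R i) atTop atTop ∧
        ∀ τ : ℝ, max (Kerr.rPlus (d.mass i) (d.spin i)) 0 + 1 ≤ R i τ) ∧
      (∀ τ₁ : ℝ, d.τ₀ < τ₁ →
        O \ d.certifiedLate R τ₁ ⊆ 𝒟.metric.causalPast 𝒟.timeOrientation (d.certifiedSlab R τ₁)) ∧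
      (∀ i : Fin d.N, Summit.FinalStateConjecture.IsOrthochronous (d.motion i).1) ∧
      (∀ (i : Fin d.N) (ρ : ℝ), ∀ᶠ τ in atTop, ∀ x ∈ (d.background i).truncTimeSlab ρ τ, ∀ w : E4,
        𝒟.timeOrientation.IsFutureDirected (mfderiv 𝓘(ℝ, E4) (𝓡 4) (d.chart i) x w) →
          0 < ((d.motion i).1 : E4 ≃L[ℝ] E4).symm w 0) ∧
      (∀ᶠ τ in atTop, ∀ x ∈ (Minkowski.backgroundOn d.flatDomain).timeSlab τ,
        𝒟.timeOrientation.IsFutureDirected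
          (mfderiv 𝓘(ℝ, E4) (𝓡 4) d.flatChart x (E4.basisVector 0))) ∧
      (∀ k : ℕ, Tendsto (fun τ ↦ 𝒟.toSpacetime.deviationCk (Minkowski.backgroundOn d.flatDomain)
        d.flatChart k τ) atTop (𝓝 0)) :=
  Iff.rfl

/-- Unfolding lemma for `IsSettledSystem`. [folklore] -/
theorem isSettledSystem_iff (𝒟 : VacuumCauchyDevelopment D) (O' : Set 𝒟.carrier)
    (d' : FinalStateDecomposition 𝒟.toSpacetime O' 2) :
    IsSettledSystem 𝒟 O' d' ↔
      (∀ i, Kerr.IsSubextremal (d'.mass i) (d'.spin i)) ∧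
      O' = Summit.FinalStateConjecture.exteriorOf 𝒟.toCauchyDevelopment d'.charted ∧
      Summit.FinalStateConjecture.RaysStayInClosure 𝒟.toCauchyDevelopment O' ∧
      Summit.FinalStateConjecture.HasExhaustiveCharts d' ∧
      (∀ i : Fin d'.N, Summit.FinalStateConjecture.IsOrthochronous (d'.motion i).1) ∧
      (∀ (i : Fin d'.N) (ρ : ℝ), ∀ᶠ τ in atTop, ∀ x ∈ (d'.background i).truncTimeSlab ρ τ, ∀ w : E4,
        𝒟.timeOrientation.IsFutureDirected (mfderiv 𝓘(ℝ, E4) (𝓡 4) (d'.chart i) x w) →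
          0 < ((d'.motion i).1 : E4 ≃L[ℝ] E4).symm w 0) ∧
      (∀ᶠ τ in atTop, ∀ x ∈ (Minkowski.backgroundOn d'.flatDomain).timeSlab τ,
        𝒟.timeOrientation.IsFutureDirected
          (mfderiv 𝓘(ℝ, E4) (𝓡 4) d'.flatChart x (E4.basisVector 0))) :=
  Iff.rfl

end Development

/-! ### Registered helper (so that this definitions file can be attached to the crux item) -/

/-- **Tail recursion of an `ℝ≥0∞` series** (`dyadicCaptureDefs_tail_succ`, the name under which this
definitions file is attached to the crux item stmt-FinalStateConjecture-17488): `Σⱼ e(j+n) = e(n) + Σⱼ e(j+n+1)`.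
[folklore] -/
theorem dyadicCaptureDefs_tail_succ : ∀ (e : ℕ → ENNReal) (n : ℕ), (∑' j : ℕ, e (j + n)) = e n + ∑' j : ℕ, e (j + (n + 1)) := by
  intro e n
  rw [← Summable.sum_add_tsum_nat_add' (f := fun j ↦ e (j + n)) (k := 1) ENNReal.summable]
  simp only [Finset.range_one, Finset.sum_singleton, zero_add]
  congr 1
  exact tsum_congr fun j ↦ by congr 1; omega

end Summit.FinalStateConjecture.FinalStateConjecture.Theorems

end
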